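import Summits.ABC.StewartYu.PadicMulticubic
import HarnessLib

/-!
# Cell abc-stewartyu, WP-Y2 / `TwoAdicPrincipalCubic`: the multicubic algebra (II: the NORM TO THE
# PREVIOUS FLOOR `x · cof(x) = N(x)`, its non-vanishing, sizes and denominators)

`Summits/ABC/StewartYu/PadicMulticubicNorm.lean` — cell `abc-stewartyu` (lit seat g3; theorems and
plain definitions only, no named fact), sequel to `PadicMulticubic.lean`. For a coefficient vector
`c` over `k + 1` cube roots write `x = ev3 t c = A + t_k B + t_k² C` (`ev3_succ`), `t_k³ = a = αₖ`.

* `cofSlices`, `cofVec`: the cofactor `cof(x) = (A² − aBC) + (aC² − AB) t_k + (B² − AC) t_k²`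
  as a vector over `k + 1` roots; `normVec`: the norm `N(x) = A³ + aB³ + a²C³ − 3aABC` as a
  vector over the first `k` roots (`cmul3`-products of the slices);
* `ev3_mul_ev3_cofVec : ev3 t c · ev3 t (cofVec α c) = ev3 (init3 t) (normVec α c)` — the norm
  form of a pure cubic step (`Literature.Barriers.ABC.Multicubic.cubicNorm_eq_mul_cofactor`); this
  replaces the conjugation `x x̄ = u² − αv²` of the `q = 2` files, and NO cube root of unity is
  needed anywhere;
* `ev3_normVec_ne_zero`, `normVec_ne_zero`, `ev3_cofVec_ne_zero`: `N(x) ≠ 0` for `c ≠ 0` under the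
  `3`-Kummer condition (`Literature.Barriers.ABC.Multicubic.cubicNorm_ne_zero_of_cube_eq`: `αₖ` is
  not a cube in `ℚ(t₀, …, t_{k-1})`, and `A, B, C` are not all zero by `ev3_ne_zero`);
* sizes `sum_abs_cofVec_le` (`∑|cof| ≤ 6 max(1,|αₖ|) Hₖ M²`), `sum_abs_normVec_le`
  (`∑|N| ≤ 6 max(1,|αₖ|)² Hₖ² M³`), `Hₖ = ∏_{j<k} max(1,|αⱼ|)`; denominators `exists_int_cofVec`
  (`D²`), `exists_int_normVec` (`D³`) for integer generators.

Everything is [folklore]; nothing here is claimed to be in print. Sequels: `PadicMulticubicLiouville.lean`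
(the Liouville inequality at the third points in an arbitrary ultrametric field) and
`PadicMulticubicLiouvillePadic.lean` (its `ℚ_p` instance).
-/

noncomputable section

open Finset

namespace Summit.ABC.StewartYu

namespace Multicub

variable {L : Type*} [Field L] [CharZero L]
variable {k : ℕ}

/-! ### The norm to the previous floor: `x · cof(x) = N(x)` -/

section Norm

variable (α' : Fin (k + 1) → ℚ) (c : (Fin (k + 1) → Fin 3) → ℚ)

/-- The three slices of the COFACTOR of `x = A + tB + t²C` (`t³ = a`):
`cof(x) = (A² − aBC) + (aC² − AB) t + (B² − AC) t²`, as coefficient vectors over the first `k`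
roots. [folklore] -/
def cofSlices : Fin 3 → (Fin k → Fin 3) → ℚ :=
  ![cmul3 (initα α') (slice c 0) (slice c 0) - α' (Fin.last k) • cmul3 (initα α') (slice c 1) (slice c 2),
    α' (Fin.last k) • cmul3 (initα α') (slice c 2) (slice c 2) - cmul3 (initα α') (slice c 0) (slice c 1),
    cmul3 (initα α') (slice c 1) (slice c 1) - cmul3 (initα α') (slice c 0) (slice c 2)]

/-- The cofactor vector over `k + 1` roots. [folklore] -/
def cofVec : (Fin (k + 1) → Fin 3) → ℚ := glue (cofSlices α' c)

/-- The NORM vector over the first `k` roots: `N(x) = A³ + aB³ + a²C³ − 3aABC`. [folklore] -/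
def normVec : (Fin k → Fin 3) → ℚ :=
  cmul3 (initα α') (slice c 0) (cmul3 (initα α') (slice c 0) (slice c 0)) +
    α' (Fin.last k) • cmul3 (initα α') (slice c 1) (cmul3 (initα α') (slice c 1) (slice c 1)) +
    (α' (Fin.last k) ^ 2) • cmul3 (initα α') (slice c 2) (cmul3 (initα α') (slice c 2) (slice c 2)) -
    (3 * α' (Fin.last k)) • cmul3 (initα α') (slice c 0) (cmul3 (initα α') (slice c 1) (slice c 2))

variable {α' c}

/-- The slices of the cofactor vector. [folklore] -/
theorem slice_cofVec (r : Fin 3) : slice (cofVec α' c) r = cofSlices α' c r := by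
  rw [cofVec, slice_glue]

/-- `ev3 (init3 t) (normVec) = A³ + aB³ + a²C³ − 3aABC`. [folklore] -/
theorem ev3_normVec (t : Fin (k + 1) → L) (ht : ∀ j, t j ^ 3 = (α' j : L)) :
    ev3 (init3 t) (normVec α' c) =
      ev3 (init3 t) (slice c 0) ^ 3 + t (Fin.last k) ^ 3 * ev3 (init3 t) (slice c 1) ^ 3 +
        (t (Fin.last k) ^ 3) ^ 2 * ev3 (init3 t) (slice c 2) ^ 3 -
        3 * t (Fin.last k) ^ 3 * ev3 (init3 t) (slice c 0) * ev3 (init3 t) (slice c 1) *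
          ev3 (init3 t) (slice c 2) := by
  have hti := init3_pow_three α' t ht
  unfold normVec
  simp only [ev3_sub, ev3_add, ev3_smul, ev3_cmul3 (initα α') (init3 t) hti]
  rw [ht (Fin.last k)]
  push_cast
  ring

/-- `ev3 t (cofVec) = (A² − aBC) + t(aC² − AB) + t²(B² − AC)`. [folklore] -/
theorem ev3_cofVec (t : Fin (k + 1) → L) (ht : ∀ j, t j ^ 3 = (α' j : L)) :
    ev3 t (cofVec α' c) =
      (ev3 (init3 t) (slice c 0) ^ 2 -
          t (Fin.last k) ^ 3 * ev3 (init3 t) (slice c 1) * ev3 (init3 t) (slice c 2)) +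
        (t (Fin.last k) ^ 3 * ev3 (init3 t) (slice c 2) ^ 2 -
          ev3 (init3 t) (slice c 0) * ev3 (init3 t) (slice c 1)) * t (Fin.last k) +
        (ev3 (init3 t) (slice c 1) ^ 2 - ev3 (init3 t) (slice c 0) * ev3 (init3 t) (slice c 2)) *
          t (Fin.last k) ^ 2 := by
  have hti := init3_pow_three α' t ht
  rw [ev3_succ, slice_cofVec, slice_cofVec, slice_cofVec]
  unfold cofSlices
  simp only [Matrix.cons_val_zero, Matrix.cons_val_one, Matrix.cons_val_two, Matrix.head_cons,
    Matrix.tail_cons, ev3_sub, ev3_smul, ev3_cmul3 (initα α') (init3 t) hti]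
  rw [ht (Fin.last k)]
  ring

/-- **`x · cof(x) = N(x)`:** `ev3 t c · ev3 t (cofVec) = ev3 (init3 t) (normVec)` — the norm of
the value to the previous floor of the tower (lit's `Multicubic.cubicNorm_eq_mul_cofactor`).
[folklore] -/
theorem ev3_mul_ev3_cofVec (t : Fin (k + 1) → L) (ht : ∀ j, t j ^ 3 = (α' j : L)) :
    ev3 t c * ev3 t (cofVec α' c) = ev3 (init3 t) (normVec α' c) := by
  rw [ev3_cofVec t ht, ev3_normVec t ht, ev3_succ t c]
  ring

/-- Evaluations lie in the field generated by the roots. [folklore] -/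
theorem ev3_mem_adjoin (t : Fin k → L) (d : (Fin k → Fin 3) → ℚ) :
    ev3 t d ∈ IntermediateField.adjoin ℚ (Set.range t) := by
  unfold ev3 mono3
  refine sum_mem fun l _ => mul_mem ?_ (prod_mem fun j _ => pow_mem ?_ _)
  · rw [← eq_ratCast (algebraMap ℚ L)]
    exact IntermediateField.algebraMap_mem _ _
  · exact IntermediateField.subset_adjoin ℚ _ ⟨j, rfl⟩

/-- **`N(x) ≠ 0` for `c ≠ 0`** under the `3`-Kummer condition on `α₀, …, αₖ` (lit's
`Multicubic.cubicNorm_ne_zero_of_cube_eq`: `aₖ` is not a cube in `ℚ(t₀, …, t_{k-1})`, and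
`A, B, C` are not all zero by linear independence of the monomials). [folklore] -/
theorem ev3_normVec_ne_zero
    (hind : ∀ κ : Fin (k + 1) → ℕ, (∃ j, ¬ 3 ∣ κ j) → ∀ γ : ℚ, ∏ j, α' j ^ κ j ≠ γ ^ 3)
    (t : Fin (k + 1) → L) (ht : ∀ j, t j ^ 3 = (α' j : L)) (hc : c ≠ 0) :
    ev3 (init3 t) (normVec α' c) ≠ 0 := by
  have h3 : (3 : L) ≠ 0 := by
    rw [show (3 : L) = algebraMap ℚ L 3 from (map_ofNat (algebraMap ℚ L) 3).symm]
    exact (_root_.map_ne_zero _).mpr three_ne_zero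
  have hti := init3_pow_three α' t ht
  -- `A, B, C` are not all zero
  have h0 : ¬ (ev3 (init3 t) (slice c 0) = 0 ∧ ev3 (init3 t) (slice c 1) = 0 ∧
      ev3 (init3 t) (slice c 2) = 0) := by
    obtain ⟨r, hr⟩ := slice_ne_zero_of_ne_zero hc
    have hne := ev3_ne_zero (initα α') (hind_init hind) (init3 t) hti hr
    rintro ⟨h₀, h₁, h₂⟩
    fin_cases r
    · exact hne h₀
    · exact hne h₁
    · exact hne h₂
  rw [ev3_normVec t ht]
  exact Literature.Barriers.ABC.Multicubic.cubicNorm_ne_zero_of_cube_eq h3 α' t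
    (fun j => by rw [ht j, eq_ratCast]) hind (ev3_mem_adjoin _ _) (ev3_mem_adjoin _ _)
    (ev3_mem_adjoin _ _) h0

/-- `N(x) ≠ 0` as a coefficient vector. [folklore] -/
theorem normVec_ne_zero
    (hind : ∀ κ : Fin (k + 1) → ℕ, (∃ j, ¬ 3 ∣ κ j) → ∀ γ : ℚ, ∏ j, α' j ^ κ j ≠ γ ^ 3)
    (t : Fin (k + 1) → L) (ht : ∀ j, t j ^ 3 = (α' j : L)) (hc : c ≠ 0) : normVec α' c ≠ 0 := by
  intro h
  have := ev3_normVec_ne_zero hind t ht hc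
  rw [h, ev3_zero] at this
  exact this rfl

/-- `cof(x) ≠ 0` (it divides `N(x) ≠ 0`). [folklore] -/
theorem ev3_cofVec_ne_zero
    (hind : ∀ κ : Fin (k + 1) → ℕ, (∃ j, ¬ 3 ∣ κ j) → ∀ γ : ℚ, ∏ j, α' j ^ κ j ≠ γ ^ 3)
    (t : Fin (k + 1) → L) (ht : ∀ j, t j ^ 3 = (α' j : L)) (hc : c ≠ 0) :
    ev3 t (cofVec α' c) ≠ 0 := by
  intro h
  have := ev3_mul_ev3_cofVec (c := c) t ht
  rw [h, mul_zero] at this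
  exact ev3_normVec_ne_zero hind t ht hc this.symm

end Norm


/-! ### Sizes and denominators of the norm and cofactor vectors -/

section NormSizes

variable {α' : Fin (k + 1) → ℚ} {c : (Fin (k + 1) → Fin 3) → ℚ}

/-- `ℓ¹`-norm of a scalar multiple. [folklore] -/
theorem sum_abs_smul (q : ℚ) (v : (Fin k → Fin 3) → ℚ) :
    ∑ l, |((q • v) l : ℝ)| = |(q : ℝ)| * ∑ l, |(v l : ℝ)| := by
  rw [Finset.mul_sum]
  refine Finset.sum_congr rfl fun l _ => ?_
  rw [Pi.smul_apply, smul_eq_mul, Rat.cast_mul, abs_mul]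

/-- `ℓ¹`-norm of a sum. [folklore] -/
theorem sum_abs_add_le (v w : (Fin k → Fin 3) → ℚ) :
    ∑ l, |((v + w) l : ℝ)| ≤ ∑ l, |(v l : ℝ)| + ∑ l, |(w l : ℝ)| := by
  rw [← Finset.sum_add_distrib]
  refine Finset.sum_le_sum fun l _ => ?_
  rw [Pi.add_apply, Rat.cast_add]
  exact abs_add_le _ _

/-- `ℓ¹`-norm of a difference. [folklore] -/
theorem sum_abs_sub_le (v w : (Fin k → Fin 3) → ℚ) :
    ∑ l, |((v - w) l : ℝ)| ≤ ∑ l, |(v l : ℝ)| + ∑ l, |(w l : ℝ)| := by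
  rw [← Finset.sum_add_distrib]
  refine Finset.sum_le_sum fun l _ => ?_
  rw [Pi.sub_apply, Rat.cast_sub]
  exact abs_sub _ _

/-- `ℓ¹`-norm of a glued vector = sum of the `ℓ¹`-norms of the pieces. [folklore] -/
theorem sum_abs_glue (d : Fin 3 → (Fin k → Fin 3) → ℚ) :
    ∑ l, |(glue d l : ℝ)| = ∑ r, ∑ l', |(d r l' : ℝ)| := by
  rw [← (Fin.snocEquiv fun _ : Fin (k + 1) => Fin 3).sum_comp, Fintype.sum_prod_type]
  have hsn : ∀ (r : Fin 3) (l : Fin k → Fin 3),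
      (Fin.snocEquiv fun _ : Fin (k + 1) => Fin 3) (r, l) = Fin.snoc l r := fun r l => rfl
  simp only [hsn, glue, Fin.snoc_last, Fin.init_snoc]

/-- Integer multiples keep the denominator. [folklore] -/
theorem exists_int_smul_int {v : (Fin k → Fin 3) → ℚ} {D : ℕ}
    (hv : ∀ l, ∃ z : ℤ, (D : ℚ) * v l = z) (m : ℤ) (l : Fin k → Fin 3) :
    ∃ z : ℤ, (D : ℚ) * ((m : ℚ) • v) l = z := by
  obtain ⟨z, hz⟩ := hv l
  exact ⟨m * z, by rw [Pi.smul_apply, smul_eq_mul, mul_left_comm, hz, Int.cast_mul]⟩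

/-- Sums keep a common denominator. [folklore] -/
theorem exists_int_add {v w : (Fin k → Fin 3) → ℚ} {D : ℕ}
    (hv : ∀ l, ∃ z : ℤ, (D : ℚ) * v l = z) (hw : ∀ l, ∃ z : ℤ, (D : ℚ) * w l = z)
    (l : Fin k → Fin 3) : ∃ z : ℤ, (D : ℚ) * (v + w) l = z := by
  obtain ⟨z, hz⟩ := hv l
  obtain ⟨z', hz'⟩ := hw l
  exact ⟨z + z', by rw [Pi.add_apply, mul_add, hz, hz', Int.cast_add]⟩

/-- Differences keep a common denominator. [folklore] -/
theorem exists_int_sub {v w : (Fin k → Fin 3) → ℚ} {D : ℕ}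
    (hv : ∀ l, ∃ z : ℤ, (D : ℚ) * v l = z) (hw : ∀ l, ∃ z : ℤ, (D : ℚ) * w l = z)
    (l : Fin k → Fin 3) : ∃ z : ℤ, (D : ℚ) * (v - w) l = z := by
  obtain ⟨z, hz⟩ := hv l
  obtain ⟨z', hz'⟩ := hw l
  exact ⟨z - z', by rw [Pi.sub_apply, mul_sub, hz, hz', Int.cast_sub]⟩

/-- **Denominators of the cofactor vector:** `D² · cof ∈ ℤ` (integer generators). [folklore] -/
theorem exists_int_cofVec (hα : ∀ j, ∃ a : ℤ, α' j = a) {D : ℕ}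
    (hden : ∀ l, ∃ z : ℤ, (D : ℚ) * c l = z) (l : Fin (k + 1) → Fin 3) :
    ∃ z : ℤ, ((D * D : ℕ) : ℚ) * cofVec α' c l = z := by
  have hαi : ∀ j, ∃ a : ℤ, initα α' j = a := fun j => hα _
  obtain ⟨a, ha⟩ := hα (Fin.last k)
  have hsl : ∀ r l', ∃ z : ℤ, (D : ℚ) * slice c r l' = z := slice_den c hden
  have hcm : ∀ r r' l', ∃ z : ℤ, ((D * D : ℕ) : ℚ) * cmul3 (initα α') (slice c r) (slice c r') l' = z :=
    fun r r' => exists_int_cmul3 (initα α') hαi _ _ (hsl r) (hsl r')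
  unfold cofVec glue cofSlices
  set l' := Fin.init l
  -- case on the last exponent
  have h3 : ∀ r : Fin 3, ∃ z : ℤ, ((D * D : ℕ) : ℚ) *
      (![cmul3 (initα α') (slice c 0) (slice c 0) - α' (Fin.last k) • cmul3 (initα α') (slice c 1) (slice c 2),
        α' (Fin.last k) • cmul3 (initα α') (slice c 2) (slice c 2) - cmul3 (initα α') (slice c 0) (slice c 1),
        cmul3 (initα α') (slice c 1) (slice c 1) - cmul3 (initα α') (slice c 0) (slice c 2)] r) l' = z := by
    intro r
    fin_cases r
    · simp only [Fin.zero_eta, Matrix.cons_val_zero]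
      rw [ha]
      exact exists_int_sub (hcm 0 0) (exists_int_smul_int (hcm 1 2) a) l'
    · simp only [Fin.mk_one, Matrix.cons_val_one]
      rw [ha]
      exact exists_int_sub (exists_int_smul_int (hcm 2 2) a) (hcm 0 1) l'
    · simp only [Fin.reduceFinMk, Matrix.cons_val]
      exact exists_int_sub (hcm 1 1) (hcm 0 2) l'
  exact h3 _

/-- **Denominators of the norm vector:** `D³ · N ∈ ℤ` (integer generators). [folklore] -/
theorem exists_int_normVec (hα : ∀ j, ∃ a : ℤ, α' j = a) {D : ℕ}
    (hden : ∀ l, ∃ z : ℤ, (D : ℚ) * c l = z) (l : Fin k → Fin 3) :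
    ∃ z : ℤ, ((D * (D * D) : ℕ) : ℚ) * normVec α' c l = z := by
  have hαi : ∀ j, ∃ a : ℤ, initα α' j = a := fun j => hα _
  obtain ⟨a, ha⟩ := hα (Fin.last k)
  have hsl : ∀ r l', ∃ z : ℤ, (D : ℚ) * slice c r l' = z := slice_den c hden
  have hcm : ∀ r r' l', ∃ z : ℤ, ((D * D : ℕ) : ℚ) *
      cmul3 (initα α') (slice c r) (slice c r') l' = z :=
    fun r r' => exists_int_cmul3 (initα α') hαi _ _ (hsl r) (hsl r')
  have hcmm : ∀ r r' r'' l', ∃ z : ℤ, ((D * (D * D) : ℕ) : ℚ) *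
      cmul3 (initα α') (slice c r) (cmul3 (initα α') (slice c r') (slice c r'')) l' = z :=
    fun r r' r'' => exists_int_cmul3 (initα α') hαi _ _ (hsl r) (hcm r' r'')
  unfold normVec
  rw [ha, show ((a : ℚ)) ^ 2 = ((a ^ 2 : ℤ) : ℚ) by push_cast; ring,
    show (3 * (a : ℚ)) = ((3 * a : ℤ) : ℚ) by push_cast; ring]
  exact exists_int_sub (exists_int_add (exists_int_add (hcmm 0 0 0)
    (exists_int_smul_int (hcmm 1 1 1) a)) (exists_int_smul_int (hcmm 2 2 2) (a ^ 2)))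
    (exists_int_smul_int (hcmm 0 1 2) (3 * a)) l

/-- **Size of the cofactor vector:** `∑ |cof| ≤ 6 · max(1,|aₖ|) · (∏_{j<k} max(1,|αⱼ|)) · M²`.
[folklore] -/
theorem sum_abs_cofVec_le {M : ℝ} (hM0 : 0 ≤ M) (hcM : ∑ l, |(c l : ℝ)| ≤ M) :
    ∑ l, |(cofVec α' c l : ℝ)| ≤
      6 * max 1 |(α' (Fin.last k) : ℝ)| * (∏ j, max 1 |(initα α' j : ℝ)|) * M ^ 2 := by
  set A : ℝ := max 1 |(α' (Fin.last k) : ℝ)| with hA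
  set Hk : ℝ := ∏ j, max 1 |(initα α' j : ℝ)| with hHk
  have hA1 : 1 ≤ A := le_max_left _ _
  have hsl : ∀ r, ∑ l, |(slice c r l : ℝ)| ≤ M := fun r => (sum_abs_slice_le c r).trans hcM
  have hsl0 : ∀ r, 0 ≤ ∑ l, |(slice c r l : ℝ)| := fun r => Finset.sum_nonneg fun _ _ => abs_nonneg _
  have hcm : ∀ r r', ∑ l, |(cmul3 (initα α') (slice c r) (slice c r') l : ℝ)| ≤ Hk * M ^ 2 := by
    intro r r'
    refine (l1_cmul3_le _ _ _).trans ?_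
    rw [← hHk, sq]
    exact mul_le_mul_of_nonneg_left (mul_le_mul (hsl r) (hsl r') (hsl0 r') hM0) (by positivity)
  have haA : |(α' (Fin.last k) : ℝ)| ≤ A := le_max_right _ _
  rw [cofVec, sum_abs_glue, Fin.sum_univ_three]
  unfold cofSlices
  simp only [Matrix.cons_val_zero, Matrix.cons_val_one, Matrix.cons_val_two, Matrix.head_cons,
    Matrix.tail_cons]
  have h0 : ∑ l', |((cmul3 (initα α') (slice c 0) (slice c 0) -
      α' (Fin.last k) • cmul3 (initα α') (slice c 1) (slice c 2)) l' : ℝ)| ≤ Hk * M ^ 2 + A * (Hk * M ^ 2) := by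
    refine (sum_abs_sub_le _ _).trans (add_le_add (hcm 0 0) ?_)
    rw [sum_abs_smul]
    exact mul_le_mul haA (hcm 1 2) (Finset.sum_nonneg fun _ _ => abs_nonneg _) (by positivity)
  have h1 : ∑ l', |((α' (Fin.last k) • cmul3 (initα α') (slice c 2) (slice c 2) -
      cmul3 (initα α') (slice c 0) (slice c 1)) l' : ℝ)| ≤ A * (Hk * M ^ 2) + Hk * M ^ 2 := by
    refine (sum_abs_sub_le _ _).trans (add_le_add ?_ (hcm 0 1))
    rw [sum_abs_smul]
    exact mul_le_mul haA (hcm 2 2) (Finset.sum_nonneg fun _ _ => abs_nonneg _) (by positivity)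
  have h2 : ∑ l', |((cmul3 (initα α') (slice c 1) (slice c 1) -
      cmul3 (initα α') (slice c 0) (slice c 2)) l' : ℝ)| ≤ Hk * M ^ 2 + Hk * M ^ 2 :=
    (sum_abs_sub_le _ _).trans (add_le_add (hcm 1 1) (hcm 0 2))
  have hHM : 0 ≤ Hk * M ^ 2 := by positivity
  have hHM' : Hk * M ^ 2 ≤ A * (Hk * M ^ 2) := le_mul_of_one_le_left hHM hA1
  calc _ ≤ (Hk * M ^ 2 + A * (Hk * M ^ 2)) + (A * (Hk * M ^ 2) + Hk * M ^ 2) +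
        (Hk * M ^ 2 + Hk * M ^ 2) := add_le_add (add_le_add h0 h1) h2
    _ ≤ 6 * A * Hk * M ^ 2 := by nlinarith

/-- **Size of the norm vector:** `∑ |N| ≤ 6 · max(1,|aₖ|)² · (∏_{j<k} max(1,|αⱼ|))² · M³`. [folklore] -/
theorem sum_abs_normVec_le {M : ℝ} (hM0 : 0 ≤ M) (hcM : ∑ l, |(c l : ℝ)| ≤ M) :
    ∑ l, |(normVec α' c l : ℝ)| ≤
      6 * (max 1 |(α' (Fin.last k) : ℝ)|) ^ 2 * (∏ j, max 1 |(initα α' j : ℝ)|) ^ 2 * M ^ 3 := by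
  set A : ℝ := max 1 |(α' (Fin.last k) : ℝ)| with hA
  set Hk : ℝ := ∏ j, max 1 |(initα α' j : ℝ)| with hHk
  have hA1 : 1 ≤ A := le_max_left _ _
  have hsl : ∀ r, ∑ l, |(slice c r l : ℝ)| ≤ M := fun r => (sum_abs_slice_le c r).trans hcM
  have hsl0 : ∀ r, 0 ≤ ∑ l, |(slice c r l : ℝ)| := fun r => Finset.sum_nonneg fun _ _ => abs_nonneg _
  have hcm : ∀ r r', ∑ l, |(cmul3 (initα α') (slice c r) (slice c r') l : ℝ)| ≤ Hk * M ^ 2 := by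
    intro r r'
    refine (l1_cmul3_le _ _ _).trans ?_
    rw [← hHk, sq]
    exact mul_le_mul_of_nonneg_left (mul_le_mul (hsl r) (hsl r') (hsl0 r') hM0) (by positivity)
  have hcmm : ∀ r r' r'', ∑ l, |(cmul3 (initα α') (slice c r)
      (cmul3 (initα α') (slice c r') (slice c r'')) l : ℝ)| ≤ Hk ^ 2 * M ^ 3 := by
    intro r r' r''
    refine (l1_cmul3_le _ _ _).trans ?_
    rw [← hHk]
    calc Hk * ((∑ l, |(slice c r l : ℝ)|) * ∑ l', |(cmul3 (initα α') (slice c r') (slice c r'') l' : ℝ)|)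
        ≤ Hk * (M * (Hk * M ^ 2)) :=
          mul_le_mul_of_nonneg_left (mul_le_mul (hsl r) (hcm r' r'')
            (Finset.sum_nonneg fun _ _ => abs_nonneg _) hM0) (by positivity)
      _ = Hk ^ 2 * M ^ 3 := by ring
  have haA : |(α' (Fin.last k) : ℝ)| ≤ A := le_max_right _ _
  unfold normVec
  have e1 := hcmm 0 0 0
  have e2 : ∑ l, |((α' (Fin.last k) • cmul3 (initα α') (slice c 1)
      (cmul3 (initα α') (slice c 1) (slice c 1))) l : ℝ)| ≤ A * (Hk ^ 2 * M ^ 3) := by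
    rw [sum_abs_smul]
    exact mul_le_mul haA (hcmm 1 1 1) (Finset.sum_nonneg fun _ _ => abs_nonneg _) (by positivity)
  have e3 : ∑ l, |(((α' (Fin.last k)) ^ 2 • cmul3 (initα α') (slice c 2)
      (cmul3 (initα α') (slice c 2) (slice c 2))) l : ℝ)| ≤ A ^ 2 * (Hk ^ 2 * M ^ 3) := by
    rw [sum_abs_smul, Rat.cast_pow, abs_pow]
    exact mul_le_mul (pow_le_pow_left₀ (abs_nonneg _) haA 2) (hcmm 2 2 2)
      (Finset.sum_nonneg fun _ _ => abs_nonneg _) (by positivity)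
  have e4 : ∑ l, |(((3 * α' (Fin.last k)) • cmul3 (initα α') (slice c 0)
      (cmul3 (initα α') (slice c 1) (slice c 2))) l : ℝ)| ≤ 3 * A * (Hk ^ 2 * M ^ 3) := by
    rw [sum_abs_smul, Rat.cast_mul, abs_mul, Rat.cast_ofNat, abs_of_pos (by norm_num : (0:ℝ) < 3)]
    exact mul_le_mul (mul_le_mul_of_nonneg_left haA (by norm_num)) (hcmm 0 1 2)
      (Finset.sum_nonneg fun _ _ => abs_nonneg _) (by positivity)
  have hB : 0 ≤ Hk ^ 2 * M ^ 3 := by positivity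
  have hA2 : A ≤ A ^ 2 := by nlinarith
  have hX1 : Hk ^ 2 * M ^ 3 ≤ A ^ 2 * (Hk ^ 2 * M ^ 3) :=
    le_mul_of_one_le_left hB (hA1.trans hA2)
  have hX2 : A * (Hk ^ 2 * M ^ 3) ≤ A ^ 2 * (Hk ^ 2 * M ^ 3) :=
    mul_le_mul_of_nonneg_right hA2 hB
  calc _ ≤ ((Hk ^ 2 * M ^ 3 + A * (Hk ^ 2 * M ^ 3)) + A ^ 2 * (Hk ^ 2 * M ^ 3)) +
        3 * A * (Hk ^ 2 * M ^ 3) :=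
      (sum_abs_sub_le _ _).trans (add_le_add ((sum_abs_add_le _ _).trans (add_le_add
        ((sum_abs_add_le _ _).trans (add_le_add e1 e2)) e3)) e4)
    _ ≤ 6 * A ^ 2 * Hk ^ 2 * M ^ 3 := by nlinarith

end NormSizes

end Multicub

end Summit.ABC.StewartYu

end
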